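import Summits.RiemannHypothesis.RiemannHypothesis.Theorems.SpectralThesis.Negative.BoundedTranslatesMellin
import Summits.RiemannHypothesis.RiemannHypothesis.Theorems.SpectralTraceWindowCompactness
import HarnessLib

/-!
# `SpectralThesis` (stmt-RiemannHypothesis-0187): the prime side, II — bounded translates `↔` RH

Negative-lane analysis for the route target `X = SpectralThesis` of route SpectralTrace
(refuter / cdisprove seat; supports stmt-RiemannHypothesis-0187). WHICH part of `X` ("the Weil
distribution is the Fourier–Stieltjes transform of a positive integer-atomic measure on the real
line") carries the Riemann hypothesis? Only the REALNESS of the support: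

* `riemannHypothesis_of_forall_bounded_weilTranslate` : **if `T ↦ W(g(· - T))` is bounded for every
  Weil test `g`, then RH** (classical Landau/Laplace argument, formalised with the tools of
  `BoundedTranslatesMellin.lean`: for a zero `s₀` with `1/2 < Re s₀ < 1`, the Mellin transform of the
  bounded translate function is holomorphic on `Re z > 0` but equals the partial-fraction series on
  `Re z > 1`; on the half-strip `U = {η < Re z, |Im z - Im s₀| < 1}` the tail is holomorphic, the
  finitely many nearby poles form a rational function, and clearing denominators the identity
  theorem on the convex `U` evaluates at `z = s₀ - 1/2` to `0 = m(s₀) ĝ(s₀) Π (s₀ - ρ') ≠ 0`).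
* `norm_weilFunctional_weilTranslate_le_of_trace`, `exists_bound_weilTranslate_of_complexWeightedTrace` :
  conversely any real family `γ`, even with ARBITRARY COMPLEX weights `c_i`, with
  `Σ_i c_i ĝ(1/2+iγ_i) = W(g)` (`HasSum`) for all Weil tests forces bounded translates (translation is
  unimodular on the critical line, `weilMellin_weilTranslate`).
* `forall_bounded_weilTranslate_iff_riemannHypothesis`, `complexWeightedTrace_iff_riemannHypothesis` :
  bounded translates `↔ RH`, and the relaxation of `X` with arbitrary complex weights on a real
  spectrum is again `↔ RH`. Neither positivity nor integrality of the spectral measure is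
  load-bearing for the RH-strength of `X`.
-/

noncomputable section

open Complex Set MeasureTheory Filter Asymptotics

namespace Summit.RiemannHypothesis.RiemannHypothesis.Theorems.SpectralThesis.Negative

open Literature.NumberTheory.LFunctions
open Summit.RiemannHypothesis.RiemannHypothesis.Theorems.WindowTraceArch.Negative

/-- **Bounded translates of the Weil functional force the Riemann hypothesis.** If for every Weil
test `g` the function `T ↦ W(g(· - T))` is bounded on `ℝ`, then RH holds. Proof: for a zero `s₀`
with `1/2 < Re s₀ < 1` aim a test at `s₀` (`ĝ(s₀) = ∫ b > 0`); the Laplace–Mellin transform of the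
bounded translate function is holomorphic on `Re z > 0`, but equals the partial-fraction series
`Σ_p ĝ(ρ_p)/(z - (ρ_p - 1/2))` on `Re z > 1`, whose tail is holomorphic near `s₀ - 1/2` while the
finitely many nearby terms form a rational function with a genuine pole at `s₀ - 1/2`; clearing
denominators and the identity theorem on a convex half-strip give a contradiction. [folklore] -/
theorem riemannHypothesis_of_forall_bounded_weilTranslate
    (hB : ∀ g : ℝ → ℂ, IsWeilTest g → ∃ C : ℝ, ∀ T : ℝ, ‖weilFunctional (weilTranslate g T)‖ ≤ C) :
    RiemannHypothesis := by
  classical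
  refine quasiRiemannHypothesis_one_half_iff_holds.1 fun s₀ hζ hlo hhi => ?_
  -- the zero as an element of the index of zeros, and the aimed test
  have hs₀mem : s₀ ∈ ZetaZeros.riemannZetaNontrivialZeros :=
    ZetaZeros.riemannZetaNontrivialZeros.mem_of_re_pos hζ (by linarith)
  set ρ₀ : ZetaZeros.riemannZetaNontrivialZeros := ⟨s₀, hs₀mem⟩ with hρ₀
  let b : ContDiffBump (0 : ℝ) := ⟨1, 2, one_pos, one_lt_two⟩
  set g : ℝ → ℂ := fun t : ℝ => cexp (-(s₀ - 1 / 2) * t) * (b t : ℂ) with hg_def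
  have hg : IsWeilTest g := isWeilTest_aimed s₀ b
  have hgs₀ : weilMellin g s₀ ≠ 0 := weilMellin_aimed_ne_zero s₀ b
  obtain ⟨C, hC⟩ := hB g hg
  -- geometry: `η`, `γ₀`, the half-strip `U`
  set η : ℝ := (s₀.re - 1 / 2) / 2 with hη_def
  have hη : 0 < η := by rw [hη_def]; linarith
  set γ₀ : ℝ := s₀.im with hγ₀
  set U : Set ℂ := {z : ℂ | η < z.re} ∩ ({z : ℂ | z.im < γ₀ + 1} ∩ {z : ℂ | γ₀ - 1 < z.im}) with hU
  have hUopen : IsOpen U :=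
    (isOpen_lt continuous_const Complex.continuous_re).inter
      ((isOpen_lt Complex.continuous_im continuous_const).inter
        (isOpen_lt continuous_const Complex.continuous_im))
  have hUconv : Convex ℝ U :=
    (convex_halfSpace_re_gt η).inter ((convex_halfSpace_im_lt _).inter (convex_halfSpace_im_gt _))
  -- the finite set `S` of nearby zeros in the right half of the strip, with multiplicity `E`
  set S : Set ZetaZeros.riemannZetaNontrivialZeros :=
    {ρ | |(ρ : ℂ).im - γ₀| < 2 ∧ 1 / 2 < (ρ : ℂ).re} with hS
  have hSfin : S.Finite := by
    refine Set.Finite.of_finite_image ?_ Subtype.val_injective.injOn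
    refine (riemannZetaNontrivialZeros_finite_inter_ball s₀ 3).subset ?_
    rintro w ⟨ρ, hρ, rfl⟩
    refine ⟨ρ.2, ?_⟩
    rw [Metric.mem_ball, Complex.dist_eq]
    have h1 := ZetaZeros.riemannZetaNontrivialZeros.re_lt_one ρ.2
    have hre : |((ρ : ℂ) - s₀).re| < 1 := by
      rw [sub_re, abs_lt]; constructor <;> linarith [hρ.2]
    have him : |((ρ : ℂ) - s₀).im| < 2 := by rw [sub_im]; exact hρ.1
    calc ‖(ρ : ℂ) - s₀‖ ≤ |((ρ : ℂ) - s₀).re| + |((ρ : ℂ) - s₀).im| := Complex.norm_le_abs_re_add_abs_im _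
      _ < 3 := by linarith
  set E' : Finset ZetaZeros.riemannZetaNontrivialZeros := hSfin.toFinset with hE'
  have hmemE' : ∀ ρ, ρ ∈ E' ↔ |(ρ : ℂ).im - γ₀| < 2 ∧ 1 / 2 < (ρ : ℂ).re := fun ρ => by
    rw [hE', Set.Finite.mem_toFinset]; rfl
  have hρ₀E' : ρ₀ ∈ E' := (hmemE' ρ₀).2 ⟨by simp [hρ₀, hγ₀], hlo⟩
  set E : Finset (Σ ρ : ZetaZeros.riemannZetaNontrivialZeros, Fin (Int.toNat (riemannZetaZeroOrder (ρ : ℂ)))) := E'.sigma fun _ => Finset.univ with hE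
  have hmemE : ∀ p : (Σ ρ : ZetaZeros.riemannZetaNontrivialZeros, Fin (Int.toNat (riemannZetaZeroOrder (ρ : ℂ)))), p ∈ E ↔ |(p.1 : ℂ).im - γ₀| < 2 ∧ 1 / 2 < (p.1 : ℂ).re := fun p => by
    rw [hE, Finset.mem_sigma, hmemE']; simp
  -- notation for the pieces
  set a : (Σ ρ : ZetaZeros.riemannZetaNontrivialZeros, Fin (Int.toNat (riemannZetaZeroOrder (ρ : ℂ)))) → ℂ := fun p => weilMellin g (p.1 : ℂ) with ha
  set Rtail : ℂ → ℂ := fun z => ∑' p : {p // p ∉ E}, a p.1 / (z - ((p.1.1 : ℂ) - 1 / 2)) with hRtail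
  set P : ℂ → ℂ := fun z => ∏ ρ ∈ E', (z - ((ρ : ℂ) - 1 / 2)) with hP
  set A : ZetaZeros.riemannZetaNontrivialZeros → ℂ :=
    fun ρ => ((riemannZetaZeroOrder (ρ : ℂ)).toNat : ℂ) * weilMellin g (ρ : ℂ) with hA
  set Ψ : ℂ → ℂ := fun z => ∑ ρ ∈ E', A ρ * ∏ ρ' ∈ E'.erase ρ, (z - ((ρ' : ℂ) - 1 / 2)) with hΨ
  set Φ : ℂ → ℂ := fun z => (mellin ((Set.indicator (Ioo (0 : ℝ) 1) (fun t : ℝ => weilFunctional (weilTranslate g (-Real.log t))))) z - Rtail z) * P z with hΦ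
  -- analyticity on `U`
  have hUsub : U ⊆ {z : ℂ | 0 < z.re} := fun z hz => hη.trans hz.1
  have hRtail_diff : DifferentiableOn ℂ Rtail U :=
    differentiableOn_tail hg hη E fun p hp => by rwa [hmemE] at hp
  have hP_diff : DifferentiableOn ℂ P U :=
    DifferentiableOn.fun_finsetProd fun ρ _ => differentiableOn_id.sub (differentiableOn_const _)
  have hΦ_diff : DifferentiableOn ℂ Φ U :=
    (((differentiableOn_mellin_mellinSide hg hC).mono hUsub).sub hRtail_diff).mul hP_diff
  have hΨ_diff : DifferentiableOn ℂ Ψ U := by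
    refine DifferentiableOn.fun_sum fun ρ _ => ?_
    exact (differentiableOn_const _).mul
      (DifferentiableOn.fun_finsetProd fun ρ' _ => differentiableOn_id.sub (differentiableOn_const _))
  -- the identity `Φ = Ψ` on `U ∩ {1 < Re z}`
  have hEq : EqOn Φ Ψ (U ∩ {z : ℂ | 1 < z.re}) := by
    intro z hz
    have hz1 : 1 < z.re := hz.2
    have hne : ∀ ρ : ZetaZeros.riemannZetaNontrivialZeros, z - ((ρ : ℂ) - 1 / 2) ≠ 0 := by
      intro ρ h0
      have h1 := ZetaZeros.riemannZetaNontrivialZeros.re_lt_one ρ.2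
      have := congrArg Complex.re h0
      simp only [sub_re, div_ofNat_re, one_re, zero_re] at this
      linarith
    -- `mellin f z = Σ_E + tail`
    have hsplit : mellin ((Set.indicator (Ioo (0 : ℝ) 1) (fun t : ℝ => weilFunctional (weilTranslate g (-Real.log t))))) z - Rtail z = ∑ p ∈ E, a p / (z - ((p.1 : ℂ) - 1 / 2)) := by
      rw [mellin_mellinSide_eq_tsum hg hz1, ← (summable_partialFraction hg hz1).sum_add_tsum_subtype_compl E]
      simp only [hRtail, ha, add_sub_cancel_right]
    -- group the finite part by zeros
    have hgroup : ∑ p ∈ E, a p / (z - ((p.1 : ℂ) - 1 / 2)) =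
        ∑ ρ ∈ E', A ρ / (z - ((ρ : ℂ) - 1 / 2)) := by
      rw [hE, Finset.sum_sigma]
      refine Finset.sum_congr rfl fun ρ _ => ?_
      simp only [ha, hA, Finset.sum_const, Finset.card_univ, Fintype.card_fin, nsmul_eq_mul]
      ring
    simp only [hΦ, hΨ]
    rw [hsplit, hgroup, Finset.sum_mul]
    refine Finset.sum_congr rfl fun ρ hρ => ?_
    rw [div_mul_eq_mul_div, mul_div_assoc]
    congr 1
    rw [div_eq_iff (hne ρ), hP]
    exact (Finset.prod_erase_mul E' (fun ρ' => z - ((ρ' : ℂ) - 1 / 2)) hρ).symm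
  -- identity theorem on the convex open set `U`
  set z₁ : ℂ := ⟨2, γ₀⟩ with hz₁
  have hη_lt : η < 1 / 4 := by rw [hη_def]; linarith
  have hz₁U : z₁ ∈ U := ⟨by show η < (2 : ℝ); linarith, by show (γ₀ : ℝ) < γ₀ + 1; linarith,
    by show γ₀ - 1 < (γ₀ : ℝ); linarith⟩
  have hVopen : IsOpen (U ∩ {z : ℂ | 1 < z.re}) :=
    hUopen.inter (isOpen_lt continuous_const Complex.continuous_re)
  have hz₁V : z₁ ∈ U ∩ {z : ℂ | 1 < z.re} := ⟨hz₁U, by show (1 : ℝ) < 2; norm_num⟩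
  have hEqU : EqOn Φ Ψ U :=
    (hΦ_diff.analyticOnNhd hUopen).eqOn_of_preconnected_of_eventuallyEq (hΨ_diff.analyticOnNhd hUopen)
      hUconv.isPreconnected hz₁U (eventuallyEq_of_mem (hVopen.mem_nhds hz₁V) hEq)
  -- evaluate at the pole `z⋆ = s₀ - 1/2 ∈ U`
  set zs : ℂ := s₀ - 1 / 2 with hzs
  have hzsU : zs ∈ U := by
    refine ⟨?_, ?_, ?_⟩
    · show η < (s₀ - 1 / 2).re
      simp only [sub_re, div_ofNat_re, one_re]; rw [hη_def]; linarith
    · show (s₀ - 1 / 2).im < γ₀ + 1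
      simp [hγ₀]
    · show γ₀ - 1 < (s₀ - 1 / 2).im
      simp [hγ₀]
  have hΦzs : Φ zs = 0 := by
    simp only [hΦ, hP]
    rw [Finset.prod_eq_zero hρ₀E' (by simp [hρ₀, hzs]), mul_zero]
  have hΨzs : Ψ zs ≠ 0 := by
    simp only [hΨ]
    rw [Finset.sum_eq_single_of_mem ρ₀ hρ₀E' (fun ρ hρ hne => ?_)]
    · refine mul_ne_zero (mul_ne_zero ?_ ?_) (Finset.prod_ne_zero_iff.2 fun ρ' hρ' => ?_)
      · have h1 := ZetaZeros.riemannZetaNontrivialZeros.one_le_order hs₀mem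
        have : (1 : ℕ) ≤ (riemannZetaZeroOrder (ρ₀ : ℂ)).toNat := by
          rw [hρ₀]; simp only; omega
        exact_mod_cast (Nat.one_le_iff_ne_zero.1 this)
      · simpa [hρ₀] using hgs₀
      · intro h0
        have hne' : ρ' ≠ ρ₀ := (Finset.mem_erase.1 hρ').1
        apply hne'
        apply Subtype.ext
        have : (ρ' : ℂ) = s₀ := by
          have := h0; rw [hzs] at this
          linear_combination -this
        simpa [hρ₀] using this
    · -- the other summands vanish at `zs` (their product contains the factor of `ρ₀`)
      refine mul_eq_zero_of_right _ (Finset.prod_eq_zero (Finset.mem_erase.2 ⟨hne.symm, hρ₀E'⟩) ?_)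
      simp [hρ₀, hzs]
  exact hΨzs ((hEqU hzsU).symm.trans hΦzs ▸ rfl)

/-! ## Witnesses (even with complex weights) have bounded translates -/

/-- **A witness forces bounded translates**: `‖W(g(· - T))‖ ≤ Σ_i |ĝ(1/2+iγ_i)|` for every real
`T` and every Weil test `g` (`(g(· - T))^(s) = e^{(s-1/2)T} ĝ(s)` is unimodular on `Re s = 1/2`).
Since `W(g(· - T)) = e^{T/2} ĝ(1) + e^{-T/2} ĝ(0) - Σ_n Λ(n) n^{-1/2}(g(log n - T) + g(-log n - T)) + W_∞`,
this is a smoothed prime number theorem with square-root error term. [folklore] -/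
theorem norm_weilFunctional_weilTranslate_le_of_trace {ι : Type*} {γ : ι → ℝ}
    (h : ∀ g : ℝ → ℂ, IsWeilTest g →
      HasSum (fun i => weilMellin g (1 / 2 + (γ i : ℂ) * I)) (weilFunctional g))
    {g : ℝ → ℂ} (hg : IsWeilTest g) (T : ℝ) :
    ‖weilFunctional (weilTranslate g T)‖ ≤ ∑' i, ‖weilMellin g (1 / 2 + (γ i : ℂ) * I)‖ := by
  have hT := h (weilTranslate g T) (hg.weilTranslate T)
  simp only [weilMellin_weilTranslate] at hT
  have hsumm : Summable fun i => ‖weilMellin g (1 / 2 + (γ i : ℂ) * I)‖ :=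
    summable_norm_iff.2 (h g hg).summable
  have hnorm : ∀ i, ‖cexp ((1 / 2 + (γ i : ℂ) * I - 1 / 2) * (T : ℂ)) *
      weilMellin g (1 / 2 + (γ i : ℂ) * I)‖ = ‖weilMellin g (1 / 2 + (γ i : ℂ) * I)‖ := by
    intro i
    rw [norm_mul, show (1 / 2 + (γ i : ℂ) * I - 1 / 2) * (T : ℂ) = ((γ i * T : ℝ) : ℂ) * I by
      push_cast; ring, Complex.norm_exp_ofReal_mul_I, one_mul]
  rw [← hT.tsum_eq]
  refine (norm_tsum_le_tsum_norm ?_).trans (le_of_eq (tsum_congr hnorm))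
  exact hsumm.congr fun i => (hnorm i).symm

/-- Uniform form: `sup_T ‖W(g(· - T))‖ < ∞` for every Weil test `g`. [folklore] -/
theorem exists_bound_weilTranslate_of_trace {ι : Type*} {γ : ι → ℝ}
    (h : ∀ g : ℝ → ℂ, IsWeilTest g →
      HasSum (fun i => weilMellin g (1 / 2 + (γ i : ℂ) * I)) (weilFunctional g))
    {g : ℝ → ℂ} (hg : IsWeilTest g) :
    ∃ C : ℝ, ∀ T : ℝ, ‖weilFunctional (weilTranslate g T)‖ ≤ C :=
  ⟨_, fun T => norm_weilFunctional_weilTranslate_le_of_trace h hg T⟩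

/-- **Even COMPLEX weights on a real spectrum force bounded translates**: if
`Σ_i c_i ĝ(1/2+iγ_i) = W(g)` (`HasSum`) for all Weil tests with `γ_i ∈ ℝ`, `c_i ∈ ℂ`, then
`sup_T ‖W(g(· - T))‖ ≤ Σ_i ‖c_i ĝ(1/2+iγ_i)‖ < ∞`. So neither positivity nor integrality of the
spectral measure is what carries RH in `X` — only the realness of its support (read on the prime
side as the square-root error term; the classical converse "bounded translates `→` RH" is the
Laplace-transform pole argument). [folklore] -/
theorem exists_bound_weilTranslate_of_complexWeightedTrace {ι : Type*} {γ : ι → ℝ} {c : ι → ℂ}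
    (h : ∀ g : ℝ → ℂ, IsWeilTest g →
      HasSum (fun i => c i * weilMellin g (1 / 2 + (γ i : ℂ) * I)) (weilFunctional g))
    {g : ℝ → ℂ} (hg : IsWeilTest g) (T : ℝ) :
    ‖weilFunctional (weilTranslate g T)‖ ≤ ∑' i, ‖c i * weilMellin g (1 / 2 + (γ i : ℂ) * I)‖ := by
  have hT := h (weilTranslate g T) (hg.weilTranslate T)
  simp only [weilMellin_weilTranslate] at hT
  have hsumm : Summable fun i => ‖c i * weilMellin g (1 / 2 + (γ i : ℂ) * I)‖ :=
    summable_norm_iff.2 (h g hg).summable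
  have hnorm : ∀ i, ‖c i * (cexp ((1 / 2 + (γ i : ℂ) * I - 1 / 2) * (T : ℂ)) *
      weilMellin g (1 / 2 + (γ i : ℂ) * I))‖ = ‖c i * weilMellin g (1 / 2 + (γ i : ℂ) * I)‖ := by
    intro i
    rw [norm_mul, norm_mul, norm_mul, show (1 / 2 + (γ i : ℂ) * I - 1 / 2) * (T : ℂ) =
      ((γ i * T : ℝ) : ℂ) * I by push_cast; ring, Complex.norm_exp_ofReal_mul_I, one_mul]
  rw [← hT.tsum_eq]
  refine (norm_tsum_le_tsum_norm ?_).trans (le_of_eq (tsum_congr hnorm))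
  exact hsumm.congr fun i => (hnorm i).symm


/-! ## Corollaries: bounded translates `↔` RH; complex weights `↔` RH -/

/-- Under RH the translates are bounded: `‖W(g(· - T))‖ ≤ Σ_p |ĝ(ρ_p)|` (the zero sum read on the
critical line, `eq_half_add_of_riemannHypothesis`). [folklore] -/
theorem exists_bound_weilTranslate_of_riemannHypothesis (hRH : RiemannHypothesis) {g : ℝ → ℂ}
    (hg : IsWeilTest g) : ∃ C : ℝ, ∀ T : ℝ, ‖weilFunctional (weilTranslate g T)‖ ≤ C := by
  obtain ⟨ι, γ, h⟩ := spectralThesis_of_riemannHypothesis hRH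
  exact ⟨_, fun T => norm_weilFunctional_weilTranslate_le_of_trace h hg T⟩

/-- **Bounded translates `↔` RH.** [folklore] -/
theorem forall_bounded_weilTranslate_iff_riemannHypothesis :
    (∀ g : ℝ → ℂ, IsWeilTest g → ∃ C : ℝ, ∀ T : ℝ, ‖weilFunctional (weilTranslate g T)‖ ≤ C) ↔
      RiemannHypothesis :=
  ⟨riemannHypothesis_of_forall_bounded_weilTranslate,
    fun hRH _ hg => exists_bound_weilTranslate_of_riemannHypothesis hRH hg⟩

/-- **Complex weights on a real spectrum already force RH**: if `Σ_i c_i ĝ(1/2+iγ_i) = W(g)`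
(`HasSum`) for all Weil tests with `γ_i ∈ ℝ` and `c_i ∈ ℂ`, then RH. [folklore] -/
theorem riemannHypothesis_of_complexWeightedTrace {ι : Type*} {γ : ι → ℝ} {c : ι → ℂ}
    (h : ∀ g : ℝ → ℂ, IsWeilTest g →
      HasSum (fun i => c i * weilMellin g (1 / 2 + (γ i : ℂ) * I)) (weilFunctional g)) :
    RiemannHypothesis :=
  riemannHypothesis_of_forall_bounded_weilTranslate fun _ hg =>
    ⟨_, fun T => exists_bound_weilTranslate_of_complexWeightedTrace h hg T⟩

/-- **The complex-weighted relaxation of `SpectralThesis` is equivalent to RH** — so neither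
positivity nor integrality of the spectral measure is what makes `X` RH-strength; only the
realness of its support is. [folklore] -/
theorem complexWeightedTrace_iff_riemannHypothesis :
    (∃ (ι : Type) (γ : ι → ℝ) (c : ι → ℂ), ∀ g : ℝ → ℂ, IsWeilTest g →
      HasSum (fun i => c i * weilMellin g (1 / 2 + (γ i : ℂ) * I)) (weilFunctional g)) ↔
      RiemannHypothesis := by
  constructor
  · rintro ⟨ι, γ, c, h⟩
    exact riemannHypothesis_of_complexWeightedTrace h
  · intro hRH
    obtain ⟨ι, γ, h⟩ := spectralThesis_of_riemannHypothesis hRH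
    exact ⟨ι, γ, fun _ => 1, fun g hg => by simpa using h g hg⟩

end Summit.RiemannHypothesis.RiemannHypothesis.Theorems.SpectralThesis.Negative

end
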